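import Mathlib
import HarnessLib
import Literature.Analysis.FluidPDE.VectorCalculus
import Literature.Analysis.FluidPDE.AxisymmetricEuler
import Literature.Analysis.FluidPDE.AxisymmetricVorticityTransport

/-!
# Crux `AxisTwistDoor.AveragedConeLiouville` (stmt-NavierStokesRegularity-26889), line `lrt_shell` (LEAD ns-atd-p1 g0): brick C4 —
# THE RADIAL COMPARISON DRIFT `b = (c/r) e_r = (c / r²)(x₀, x₁, 0)` is `C¹`, bounded by `|c|/r₀` and DIVERGENCE-FREE off the tube `{r ≤ r₀}`

Route `AxisTwistDoor` (NavierStokesRegularity), crux 26889 `AveragedConeLiouville`, line `lrt_shell`, the Nazarov–Ural'tseva drift of stub (5)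
`stub_fluxDecay` (LRT arXiv:2501.08976 §4, eq. Gamma-34: the one-sided absorption of the circle term into the explicit radial drift `−(C″/r)∂ᵣ`,
which is divergence-free off the axis).  For constants `c` and `r₀ > 0`, with `r = cylRadius` and `x_h = x₀ e₀ + x₁ e₁`:

* `norm_horizontal` — `‖x_h‖ = r(x)`;
* `contDiffOn_radialDrift` — `x ↦ (c / r(x)²) x_h` is `C¹` on `{r > r₀}`;
* `norm_radialDrift_le` — `‖(c / r²) x_h‖ = |c| / r ≤ |c| / r₀` there;
* `divergence_radialDrift` — `div ((c / r²) x_h) = 2c/r² − 2c/r² = 0` wherever `r(x) ≠ 0` (the planar field `x_h/|x_h|²` is the gradient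
  of `log |x_h|`, harmonic off the axis).

WHAT THIS IS NOT: not NS regularity, not the crux — a helper `--supports stmt-NavierStokesRegularity-26889 --as helper` (width seat ns-cas-k2 g0);
ACL 26889 and NS regularity are OPEN.  [cite: LeiRenTian2025, §4 p. 11 (eq. (Gamma-34), the drift −(C″/r)∂ᵣ)]
-/

noncomputable section

set_option linter.dupNamespace false

namespace Summit.NavierStokesRegularity.NavierStokesRegularity.Theorems.AveragedConeLiouville.RadialDrift

open scoped Topology InnerProductSpace
open Set Function
open Literature.Analysis Literature.Analysis.FluidPDE

/-- Components of the horizontal part `x_h = x₀ e₀ + x₁ e₁`. [folklore] -/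
theorem horizontal_apply (x : EuclideanSpace ℝ (Fin 3)) (i : Fin 3) :
    (x 0 • EuclideanSpace.single (0 : Fin 3) (1 : ℝ) + x 1 • EuclideanSpace.single (1 : Fin 3) (1 : ℝ)) i =
      if i = 0 then x 0 else if i = 1 then x 1 else 0 := by
  fin_cases i <;> simp

/-- `‖x_h‖ = r(x)`. [folklore] -/
theorem norm_horizontal (x : EuclideanSpace ℝ (Fin 3)) :
    ‖x 0 • EuclideanSpace.single (0 : Fin 3) (1 : ℝ) + x 1 • EuclideanSpace.single (1 : Fin 3) (1 : ℝ)‖ = cylRadius x := by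
  rw [EuclideanSpace.norm_eq, Fin.sum_univ_three, horizontal_apply, horizontal_apply, horizontal_apply, cylRadius]
  simp only [Fin.isValue, ↓reduceIte, Real.norm_eq_abs, sq_abs, one_ne_zero, Fin.reduceEq]
  norm_num

/-- **The radial drift is `C¹` off the tube `{r ≤ r₀}`** (`r₀ > 0`; indeed `C^∞`: a rational function with non-vanishing denominator
times a linear field). [folklore] -/
theorem contDiffOn_radialDrift (c : ℝ) {r₀ : ℝ} (hr₀ : 0 < r₀) :
    ContDiffOn ℝ 1 (fun x : EuclideanSpace ℝ (Fin 3) =>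
      (c / cylRadius x ^ 2) • (x 0 • EuclideanSpace.single (0 : Fin 3) (1 : ℝ) + x 1 • EuclideanSpace.single (1 : Fin 3) (1 : ℝ)))
      {x | r₀ < cylRadius x} := by
  have h0 : ContDiff ℝ 1 fun x : EuclideanSpace ℝ (Fin 3) => x 0 :=
    (EuclideanSpace.proj (0 : Fin 3) : EuclideanSpace ℝ (Fin 3) →L[ℝ] ℝ).contDiff
  have h1 : ContDiff ℝ 1 fun x : EuclideanSpace ℝ (Fin 3) => x 1 :=
    (EuclideanSpace.proj (1 : Fin 3) : EuclideanSpace ℝ (Fin 3) →L[ℝ] ℝ).contDiff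
  have hsq : ContDiff ℝ 1 fun x : EuclideanSpace ℝ (Fin 3) => cylRadius x ^ 2 := by
    have e : (fun x : EuclideanSpace ℝ (Fin 3) => cylRadius x ^ 2) = fun x => x 0 ^ 2 + x 1 ^ 2 := funext fun x => cylRadius_sq x
    rw [e]
    exact (h0.pow 2).add (h1.pow 2)
  refine ContDiffOn.smul (contDiffOn_const.div hsq.contDiffOn fun x hx => ?_) ?_
  · have : r₀ < cylRadius x := hx
    exact pow_ne_zero 2 (hr₀.trans this).ne'
  · exact ((h0.smul contDiff_const).add (h1.smul contDiff_const)).contDiffOn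

/-- **`‖(c/r²) x_h‖ = |c|/r ≤ |c|/r₀`** for `r(x) > r₀ > 0`. [folklore] -/
theorem norm_radialDrift_le (c : ℝ) {r₀ : ℝ} (hr₀ : 0 < r₀) {x : EuclideanSpace ℝ (Fin 3)} (hx : r₀ < cylRadius x) :
    ‖(c / cylRadius x ^ 2) • (x 0 • EuclideanSpace.single (0 : Fin 3) (1 : ℝ) + x 1 • EuclideanSpace.single (1 : Fin 3) (1 : ℝ))‖ ≤
      |c| / r₀ := by
  have hr : 0 < cylRadius x := hr₀.trans hx
  rw [norm_smul, norm_horizontal, Real.norm_eq_abs, abs_div, abs_of_pos (pow_pos hr 2),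
    show |c| / cylRadius x ^ 2 * cylRadius x = |c| / cylRadius x by field_simp]
  exact div_le_div_of_nonneg_left (abs_nonneg c) hr₀ hx.le

/-- **THE RADIAL DRIFT IS DIVERGENCE-FREE OFF THE AXIS**: `div ((c / r²) x_h) = 0` at every `x` with `r(x) ≠ 0`
(`∇(c/r²)·x_h = −2c/r²` cancels `(c/r²) div x_h = 2c/r²`). [folklore] -/
theorem divergence_radialDrift (c : ℝ) {x : EuclideanSpace ℝ (Fin 3)} (hx : cylRadius x ≠ 0) :
    VectorCalculus.divergence (fun y : EuclideanSpace ℝ (Fin 3) =>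
      (c / cylRadius y ^ 2) • (y 0 • EuclideanSpace.single (0 : Fin 3) (1 : ℝ) + y 1 • EuclideanSpace.single (1 : Fin 3) (1 : ℝ))) x = 0 := by
  set ρ2 : ℝ := cylRadius x ^ 2 with hρ2
  have hρ2ne : ρ2 ≠ 0 := pow_ne_zero 2 hx
  have hρ2eq : ρ2 = x 0 ^ 2 + x 1 ^ 2 := cylRadius_sq x
  -- the linear horizontal field and its derivative
  set P : EuclideanSpace ℝ (Fin 3) →L[ℝ] EuclideanSpace ℝ (Fin 3) :=
    (EuclideanSpace.proj (0 : Fin 3) : EuclideanSpace ℝ (Fin 3) →L[ℝ] ℝ).smulRight (EuclideanSpace.single (0 : Fin 3) (1 : ℝ)) +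
      (EuclideanSpace.proj (1 : Fin 3) : EuclideanSpace ℝ (Fin 3) →L[ℝ] ℝ).smulRight (EuclideanSpace.single (1 : Fin 3) (1 : ℝ)) with hP
  have hPy : ∀ y : EuclideanSpace ℝ (Fin 3),
      P y = y 0 • EuclideanSpace.single (0 : Fin 3) (1 : ℝ) + y 1 • EuclideanSpace.single (1 : Fin 3) (1 : ℝ) := by
    intro y; simp [hP]
  have hH : HasFDerivAt (fun y : EuclideanSpace ℝ (Fin 3) =>
      y 0 • EuclideanSpace.single (0 : Fin 3) (1 : ℝ) + y 1 • EuclideanSpace.single (1 : Fin 3) (1 : ℝ)) P x := by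
    have e : (fun y : EuclideanSpace ℝ (Fin 3) =>
        y 0 • EuclideanSpace.single (0 : Fin 3) (1 : ℝ) + y 1 • EuclideanSpace.single (1 : Fin 3) (1 : ℝ)) = fun y => P y :=
      funext fun y => (hPy y).symm
    rw [e]; exact P.hasFDerivAt
  -- the scalar factor `c / r²` and its derivative
  set D : EuclideanSpace ℝ (Fin 3) →L[ℝ] ℝ :=
    (2 * x 0) • (EuclideanSpace.proj (0 : Fin 3) : EuclideanSpace ℝ (Fin 3) →L[ℝ] ℝ) +
      (2 * x 1) • (EuclideanSpace.proj (1 : Fin 3) : EuclideanSpace ℝ (Fin 3) →L[ℝ] ℝ) with hD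
  have hsq : HasFDerivAt (fun y : EuclideanSpace ℝ (Fin 3) => cylRadius y ^ 2) D x := hasFDerivAt_cylRadius_sq x
  have hf : HasFDerivAt (fun y : EuclideanSpace ℝ (Fin 3) => c / cylRadius y ^ 2) (c • ((-(ρ2 ^ 2)⁻¹) • D)) x := by
    have h1 := ((hasDerivAt_inv hρ2ne).comp_hasFDerivAt x hsq).const_smul c
    refine h1.congr_of_eventuallyEq (Filter.Eventually.of_forall fun y => ?_)
    simp [div_eq_mul_inv]
  -- the derivative of the drift
  have hb : HasFDerivAt (fun y : EuclideanSpace ℝ (Fin 3) =>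
      (c / cylRadius y ^ 2) • (y 0 • EuclideanSpace.single (0 : Fin 3) (1 : ℝ) + y 1 • EuclideanSpace.single (1 : Fin 3) (1 : ℝ)))
      ((c / cylRadius x ^ 2) • P + (c • ((-(ρ2 ^ 2)⁻¹) • D)).smulRight
        (x 0 • EuclideanSpace.single (0 : Fin 3) (1 : ℝ) + x 1 • EuclideanSpace.single (1 : Fin 3) (1 : ℝ))) x :=
    hf.smul hH
  rw [divergence_eq_sum_inner_fderiv (EuclideanSpace.basisFun (Fin 3) ℝ), hb.fderiv]
  rw [hρ2eq] at hρ2ne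
  simp [Fin.sum_univ_three, hPy, hD, PiLp.single_apply, inner_add_right, inner_smul_right, hρ2eq, EuclideanSpace.inner_single_left,
    cylRadius_sq]
  field_simp
  ring

end Summit.NavierStokesRegularity.NavierStokesRegularity.Theorems.AveragedConeLiouville.RadialDrift

end
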